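import Summits.ABC.IUTFork.Cor312PinnedCountermodel
import Summits.ABC.IUTFork.Cor312PinnedIdentified
import Summits.ABC.IUTFork.Cor312PinnedLogShellOneRho
import Summits.ABC.IUTFork.Cor312IdentifiedBInput
import Summits.ABC.IUTFork.Cor312IdentifiedScaled
import Summits.ABC.IUTFork.Cor312LogKummerGlobal
import Summits.ABC.IUTFork.Cor312GlobalTransportNested
import HarnessLib

/-!
# IUT REPAIR branch (rung LADDER-ABC:A2.RP) — row RP-C01: Team B's COMPARISON readings as candidates (T-b / T-c / LS-profile)

Record-only, proof-only file (D-0012; NO definition, NO `Prop` fact) of the abc-iut cell, seat abc-iut-rp-cx (T-b/T-c engine;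
CANDIDATES.tsv row RP-C01, owner rp-cx). TAKES NO SIDE on [IUTchIII] Cor. 3.12. The three «candidates» are Team B's HYPOTHESES already
typed in the tree (STRONGER-THAN-PRINT of record, p412157/p412199) — abc-iut-c312-11's `Cor312Vol.VolumeTransport` (Cor312LogKummerRoute,
[IUTchIII] (xi-g) p. 184 l. 30–34 relaxed to `≤`), `Cor312Vol.GlobalVolumeTransport` (Cor312LogKummerGlobal) and `Cor312Vol.QFrobComparison`
(Cor312LogKummerRoute2, F-2767) — imported BY NAME, never asserted; typed ≠ proved; instantiated ≠ endorsed.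

THE CELLS (every prime `p`; `p = 2` is the countermodel of record):
* T-a (in tree, Team B, LEVEL S — bypasses the residual): `statement_of_volumeTransport`, `GlobalVolumeTransport.statement_of`,
  `statement_of_qFrobComparison`.
* **T-b: all three FAIL at the pinned countermodel** (`comparison_rows_fail_at_CM`): `pinnedSetting_not_volumeTransport` (abc-iut-w4-d101,
  p419720), `¬GlobalVolumeTransport` via `not_globalVolumeTransport_of_not_statement`, and `¬QFrobComparison` COMPUTED here (label 2: the
  column Frobenius-like volume of the q-image `B_1` is `−log p`, of the `m`-th Θ-image `B_4` is `−4·log p`).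
* **T-c: all three HOLD at P♭** (`comparison_rows_hold_at_linkId`, grade SAT0, via Team R's `IdentifiedReading` of P♭: `volumeTransport_of_identified`,
  `qFrobComparison_of_identified`) **and `VolumeTransport`/`QFrobComparison` hold on the log-shell family exactly for `d ≥ 3`**
  (`shell_volumeTransport_iff`, `shell_qFrobComparison_iff` — grade SAT+ at `d = 3`: honest `j²`-scaled Θ-volumes, label-independent q-volume,
  `|log(q)| > 0`), while `GlobalVolumeTransport` holds there exactly for `2d ≥ 3` (`shell_globalVolumeTransport_iff`) — the Statement's own
  profile (`shell_statement_iff`): on LS the global reading RESTATES the Statement (hulls attained), the two packetwise readings are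
  SUFFICIENT, NOT NECESSARY (`d = 2`; cf. abc-iut-c312-13 `volumeTransport_not_necessary` p413378). LS-profiles: VT = QFC = {d ≥ 3} = Licence's
  (`shell_licence_iff`), GVT = {d ≥ 2} = Statement's.
[claim: Mochizuki2012, status: disputed] [cite: ScholzeStix2018, §2.2 pp. 9–10]
-/

noncomputable section

namespace Summit.ABC.IUTFork.Repair.EvalComparison

open Thm311 Cor312 Cor312.Checks Cor312.IdentifiedNonVacuity Cor312Vol Literature.IUT.LogThetaLattice
open Cor312Vol.NaiveWitness Cor312Vol.PinnedWitness Cor312Vol.PinnedHonest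

variable (p : ℕ) [hp : Fact p.Prime]

/-! ## 1. T-b at the pinned countermodel -/

/-- **`¬QFrobComparison` at the pinned countermodel**: at label `2` (index `i = 1`), for every lattice position `m`, the column-`n`
Frobenius-like log-volume of the q-pilot image `B_1` is `−log p` and that of the `m`-th Θ-pilot Kummer image `B_4` is `−4·log p`
(the twist `(−1)^m` fixes balls). [folklore] -/
theorem pinnedSetting_not_qFrobComparison :
    ¬ QFrobComparison (S' := (naiveFull p).toLatticeSituation) (pinnedSetting p) := by
  intro h
  obtain ⟨m, hm⟩ := h ⟨1, by decide⟩ ()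
  have hj : jsq (Setting.labelSucc (T := toyIndex) ⟨1, by decide⟩) = 4 := by decide
  change pVol p _ () (twist m _ () '' (pinnedSetting p).qRegion _ ()) ≤
    pVol p _ () (twist m _ () '' (pinnedSetting p).thetaRegion m _ ()) at hm
  rw [pinnedSetting_qRegion_of_ne_zero p (Setting.labelSucc_ne_zero _), pinnedSetting_thetaRegion, hj,
    image_pBall_twist, image_pBall_twist, pVol_pBall, pVol_pBall] at hm
  have hl := log_p_pos p
  push_cast at hm
  nlinarith

/-- **`¬GlobalVolumeTransport` at the pinned countermodel** (the global reading implies the Statement, which fails there). [folklore] -/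
theorem pinnedSetting_not_globalVolumeTransport :
    ¬ GlobalVolumeTransport (S := (naiveFull p).toLatticeSituation.toSituation) (pinnedSetting p) :=
  not_globalVolumeTransport_of_not_statement _ (pinnedSetting_bridgeHyps p) (pinnedSetting_thetaRegionsAdm p)
    (pinnedSetting_not_statement p)

/-- **T-b (row RP-C01): all three comparison readings FAIL at the countermodel of record** (every prime `p`). [folklore] -/
theorem comparison_rows_fail_at_CM :
    ¬ VolumeTransport (S := (naiveFull p).toLatticeSituation.toSituation) (pinnedSetting p) ∧
      ¬ GlobalVolumeTransport (S := (naiveFull p).toLatticeSituation.toSituation) (pinnedSetting p) ∧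
      ¬ QFrobComparison (S' := (naiveFull p).toLatticeSituation) (pinnedSetting p) :=
  ⟨pinnedSetting_not_volumeTransport p, pinnedSetting_not_globalVolumeTransport p, pinnedSetting_not_qFrobComparison p⟩

/-! ## 2. T-c at P♭ (grade SAT0) -/

omit hp in
/-- The Θ-regions of any `withQDatum` setting are admissible (they are balls). [folklore] -/
theorem withQDatum_thetaRegionsAdm (qK : ∀ v : toyIndex.V, v ∈ toyIndex.Vbad → Set (signShells.StarPacket v))
    (hqK : ∀ (j : toyIndex.Label) (vQ : toyIndex.VQ), ∃ k : ℤ, pBall p j vQ k = GluedMonoids.Naive.ballOfMonoid p qK j vQ) :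
    ThetaRegionsAdm (S := (naiveFull p).toLatticeSituation.toSituation) (withQDatum p qK hqK) :=
  fun m _ vQ => ⟨jsq _, withQDatum_thetaRegion p qK hqK m _ vQ⟩

/-- **T-c (row RP-C01): all three comparison readings HOLD at P♭** (`linkIdSetting p`; Team R's `IdentifiedReading` holds there,
`linkId_reading`). Grade SAT0. [folklore] -/
theorem comparison_rows_hold_at_linkId :
    VolumeTransport (S := (naiveFull p).toLatticeSituation.toSituation) (linkIdSetting p) ∧
      GlobalVolumeTransport (S := (naiveFull p).toLatticeSituation.toSituation) (linkIdSetting p) ∧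
      QFrobComparison (S' := (naiveFull p).toLatticeSituation) (linkIdSetting p) :=
  have hvt := (linkId_reading p).volumeTransport_of_identified
  ⟨hvt, globalVolumeTransport_of_volumeTransport (linkId_bridgeHyps p) (withQDatum_thetaRegionsAdm p _ _) hvt,
    Cor312.Setting.IdentifiedReading.qFrobComparison_of_identified (S' := (naiveFull p).toLatticeSituation) (linkId_reading p)⟩

/-- T-c packaged (REPAIR-SPEC §2 item 4 shape) at `p = 2`. [folklore] -/
theorem comparison_rows_satisfiable :
    ∃ (T : ThetaIndex) (F : FullSituation T) (P : Cor312.Setting F.toLatticeSituation.toSituation)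
      (ρ : (∀ v : T.V, v ∈ T.Vbad → Set (F.L.StarPacket v)) → ∀ (j : T.Label) (vQ : T.VQ), Set (F.L.Packet j vQ))
      (qK : ∀ v : T.V, v ∈ T.Vbad → Set (F.L.StarPacket v)),
      F.Statement ∧ BridgeHyps P ∧ P.AbsLogQPos ∧ PinnedRegions3 F.toLatticeSituation P ρ qK ∧
        VolumeTransport P ∧ GlobalVolumeTransport P ∧ QFrobComparison (S' := F.toLatticeSituation) P ∧ P.Statement :=
  ⟨toyIndex, naiveFull 2, linkIdSetting 2, GluedMonoids.Naive.ballOfMonoid 2, fun v _ => Psi 2 v, naiveFull_statement 2,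
    linkId_bridgeHyps 2, linkId_absLogQPos 2, linkId_pinnedRegions3 2, (comparison_rows_hold_at_linkId 2).1,
    (comparison_rows_hold_at_linkId 2).2.1, (comparison_rows_hold_at_linkId 2).2.2, linkId_statement_via_PR1 2⟩

/-! ## 3. LS-profiles on the log-shell family `shellSetting p d` -/

section Shell

variable (d : ℕ)

omit hp in
/-- The squares of the labels of `𝔽_l^⋇` are at most `4` (`l⋇ = 2`). [folklore] -/
theorem jsq_labelSucc_le (i : Fin toyIndex.lstar) : jsq (Setting.labelSucc i) ≤ 4 := by
  unfold jsq
  have hi : ((Setting.labelSucc i : toyIndex.Label) : ℕ) ≤ 2 := Nat.le_of_lt_succ (Setting.labelSucc i).isLt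
  have : ((Setting.labelSucc i : toyIndex.Label) : ℕ) ^ 2 ≤ 2 ^ 2 := Nat.pow_le_pow_left hi 2
  exact_mod_cast this

/-- The Θ-regions of every log-shell dilate are admissible (balls). [folklore] -/
theorem shell_thetaRegionsAdm : ThetaRegionsAdm (S := (naiveFull p).toLatticeSituation.toSituation) (shellSetting p d) :=
  fun m _ vQ => ⟨_, shell_thetaRegion p d m _ vQ⟩

/-- **LS-profile of `VolumeTransport`: `{d | 3 ≤ d}`** — at label `j` the q-volume `−log p` is at most the Θ-image volume `−(j²−d)·log p`
iff `j² − d ≤ 1`; the binding label is `j = 2`. (Same threshold as the (xi-f) Licence, `shell_licence_iff`.) [folklore] -/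
theorem shell_volumeTransport_iff :
    VolumeTransport (S := (naiveFull p).toLatticeSituation.toSituation) (shellSetting p d) ↔ 3 ≤ d := by
  have hl := log_p_pos p
  have hq : ∀ (i : Fin toyIndex.lstar) (vQ : toyIndex.VQ),
      Setting.qLocal (S := (naiveFull p).toLatticeSituation.toSituation) (shellSetting p d) (Setting.labelSucc i) vQ = -Real.log p := by
    intro i vQ
    change pVol p _ vQ ((shellSetting p d).qRegion _ vQ) = _
    rw [shell_qRegion_eq, pinnedSetting_qRegion_of_ne_zero p (Setting.labelSucc_ne_zero _), pVol_pBall]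
    push_cast; ring
  have hθ : ∀ (m : ℤ) (i : Fin toyIndex.lstar) (vQ : toyIndex.VQ),
      ((naiveFull p).toLatticeSituation.toSituation.D (shellSetting p d).n).logvol (Setting.labelSucc i) vQ
        ((shellSetting p d).thetaRegion m (Setting.labelSucc i) vQ) = -((jsq (Setting.labelSucc i) - d : ℤ) : ℝ) * Real.log p := by
    intro m i vQ
    change pVol p _ vQ ((shellSetting p d).thetaRegion m _ vQ) = _
    rw [shell_thetaRegion, pVol_pBall]
  have h4 : jsq (Setting.labelSucc (T := toyIndex) ⟨1, by decide⟩) = 4 := by decide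
  constructor
  · intro h
    obtain ⟨m, hm⟩ := h ⟨1, by decide⟩ ()
    rw [hq, hθ, h4] at hm
    have h1 : ((4 - (d : ℤ) : ℤ) : ℝ) ≤ 1 := by nlinarith
    have h2 : (4 - (d : ℤ) : ℤ) ≤ 1 := by exact_mod_cast h1
    omega
  · intro hd i vQ
    refine ⟨0, ?_⟩
    rw [hq, hθ]
    have hj := jsq_labelSucc_le i
    have h1 : (jsq (Setting.labelSucc i) - d : ℤ) ≤ 1 := by omega
    have h2 : ((jsq (Setting.labelSucc i) - d : ℤ) : ℝ) ≤ 1 := by exact_mod_cast h1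
    nlinarith

/-- **LS-profile of `QFrobComparison`: `{d | 3 ≤ d}`** (the column's Frobenius-like volumes are the twisted transports of the same balls). [folklore] -/
theorem shell_qFrobComparison_iff :
    QFrobComparison (S' := (naiveFull p).toLatticeSituation) (shellSetting p d) ↔ 3 ≤ d := by
  have hl := log_p_pos p
  have hq : ∀ (m : ℤ) (i : Fin toyIndex.lstar) (vQ : toyIndex.VQ),
      ((naiveFull p).toLatticeSituation.col (shellSetting p d).n).frobLogvol m (Setting.labelSucc i) vQ
        ((shellSetting p d).qRegion (Setting.labelSucc i) vQ) = -Real.log p := by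
    intro m i vQ
    change pVol p _ vQ (twist m _ vQ '' (shellSetting p d).qRegion _ vQ) = _
    rw [shell_qRegion_eq, pinnedSetting_qRegion_of_ne_zero p (Setting.labelSucc_ne_zero _), image_pBall_twist, pVol_pBall]
    push_cast; ring
  have hθ : ∀ (m : ℤ) (i : Fin toyIndex.lstar) (vQ : toyIndex.VQ),
      ((naiveFull p).toLatticeSituation.col (shellSetting p d).n).frobLogvol m (Setting.labelSucc i) vQ
        ((shellSetting p d).thetaRegion m (Setting.labelSucc i) vQ) = -((jsq (Setting.labelSucc i) - d : ℤ) : ℝ) * Real.log p := by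
    intro m i vQ
    change pVol p _ vQ (twist m _ vQ '' (shellSetting p d).thetaRegion m _ vQ) = _
    rw [shell_thetaRegion, image_pBall_twist, pVol_pBall]
  have h4 : jsq (Setting.labelSucc (T := toyIndex) ⟨1, by decide⟩) = 4 := by decide
  constructor
  · intro h
    obtain ⟨m, hm⟩ := h ⟨1, by decide⟩ ()
    rw [hq, hθ, h4] at hm
    have h1 : ((4 - (d : ℤ) : ℤ) : ℝ) ≤ 1 := by nlinarith
    have h2 : (4 - (d : ℤ) : ℤ) ≤ 1 := by exact_mod_cast h1
    omega
  · intro hd i vQ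
    refine ⟨0, ?_⟩
    rw [hq, hθ]
    have hj := jsq_labelSucc_le i
    have h1 : (jsq (Setting.labelSucc i) - d : ℤ) ≤ 1 := by omega
    have h2 : ((jsq (Setting.labelSucc i) - d : ℤ) : ℝ) ≤ 1 := by exact_mod_cast h1
    nlinarith

/-- **LS-profile of `GlobalVolumeTransport`: `{d | 3 ≤ 2d}` = the Statement's** — on the log-shell family every packet hull is attained by
a single Kummer image (`shell_thetaHull`), so the global reading is EQUIVALENT to the Statement there (abc-iut-c312-13's
`globalVolumeTransport_iff_statement_of_hullAttained`) and `shell_statement_iff` gives the threshold. [folklore] -/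
theorem shell_globalVolumeTransport_iff :
    GlobalVolumeTransport (S := (naiveFull p).toLatticeSituation.toSituation) (shellSetting p d) ↔ 3 ≤ 2 * d := by
  rw [← shell_statement_iff p d]
  exact globalVolumeTransport_iff_statement_of_hullAttained (shell_bridgeHyps p d) (shell_thetaRegionsAdm p d)
    fun i vQ => ⟨0, by rw [(shell_thetaHull p d _ vQ).1, shell_thetaRegion]⟩

/-- **The `d = 2` dilate separates**: typed Thm. 3.11 ∧ bridge hypotheses ∧ pins hold, the Statement and the GLOBAL reading HOLD, the two
PACKETWISE comparison readings FAIL — they are sufficient, not necessary (level S), exactly like the (xi-f) Licence. [folklore] -/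
theorem shellTwo_separates :
    Cor312.Setting.Statement (shellSetting p 2) ∧
      GlobalVolumeTransport (S := (naiveFull p).toLatticeSituation.toSituation) (shellSetting p 2) ∧
      ¬ VolumeTransport (S := (naiveFull p).toLatticeSituation.toSituation) (shellSetting p 2) ∧
      ¬ QFrobComparison (S' := (naiveFull p).toLatticeSituation) (shellSetting p 2) :=
  ⟨(shell_statement_iff p 2).2 (by norm_num), (shell_globalVolumeTransport_iff p 2).2 (by norm_num),
    fun h => absurd ((shell_volumeTransport_iff p 2).1 h) (by norm_num),
    fun h => absurd ((shell_qFrobComparison_iff p 2).1 h) (by norm_num)⟩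

/-- **SAT+ witness for the packetwise readings**: at the `d = 3` dilate (honest `j²`-scaled Θ-volumes, label-independent q-volume
`−log p < 0`, pins, bridge hypotheses, typed Thm. 3.11) `VolumeTransport` and `QFrobComparison` HOLD. [folklore] -/
theorem shellThree_satPlus :
    PinnedRegions3 (naiveFull p).toLatticeSituation (shellSetting p 3) (rhoOne p 3) (qDatum p) ∧ BridgeHyps (shellSetting p 3) ∧
      (shellSetting p 3).AbsLogQPos ∧
      VolumeTransport (S := (naiveFull p).toLatticeSituation.toSituation) (shellSetting p 3) ∧
      QFrobComparison (S' := (naiveFull p).toLatticeSituation) (shellSetting p 3) ∧ Cor312.Setting.Statement (shellSetting p 3) :=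
  ⟨oneRho_pinnedRegions3 p 3, shell_bridgeHyps p 3, shell_absLogQPos p 3, (shell_volumeTransport_iff p 3).2 le_rfl,
    (shell_qFrobComparison_iff p 3).2 le_rfl, (shell_statement_iff p 3).2 (by norm_num)⟩

end Shell

end Summit.ABC.IUTFork.Repair.EvalComparison

end
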